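import Summits.BirchSwinnertonDyer.BirchSwinnertonDyer.Theorems.AlignedTransportAtTwoMainConjectureOfRankZeroBSDAtTwoCyclotomicLayerZero
import HarnessLib

/-!
# Route `AlignedTransportAtTwo`, crux C2 `MainConjectureOfRankZeroBSDAtTwo` (stmt-BirchSwinnertonDyer-22298):
# THE ALGEBRAIC WEIGHT BUDGET — in ANY `ℤ_p`-tower of ANY number field, the Mordell–Weil rank of `E` grows in at most `ord_p f_X(0)` layers
# (`f_X` a generator of `char_Λ X(E/K_∞)`), and each growth layer is a weight-one prime factor of `f_X` of the layer's degree

HONEST FRAMING (cell `bsd-f1-sign2`, WIDTH-5 attached prover seat `bsd-line-att-p5` gen 37 on line `birth` of the lead `bsd-line-att-p2`;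
`--supports` stmt-BirchSwinnertonDyer-22298, closes nothing; BSD is NOT proved by any of this; the crux C2, its verdict «blocked-on
`Rank1Residual.GreenbergMuConjectureIrreducible`» and every registered stub are untouched). THEOREMS ONLY — no `def`, no named fact, no `sorry`. The algebraic twin
of `…CyclotomicLayerWeightBudget` (this gen; there over `ℚ` on `L_p` modulo Kato): here unconditionally on the ALGEBRAIC side, for `E/K` over a number field, any
`ℤ_p`-extension `K_∞/K` with topological generator `γ`, and a dual datum `D` of `Sel_{p^∞}(E/K_∞)` with `X` finitely generated and torsion, `char_Λ X = (f_X)`.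
g36's layer dichotomy puts `Ψ_n = Φ_{p^{n+1}}(1+T)` into `f_X` at every growth layer; `Ψ_n` has weight one (`…CyclotomicLayerWeight`).

* ★★ `norm_constantCoeff_charGen_le_of_growthLayers` — **`‖f_X(0)‖ ≤ p^{−#S}` for every finite set `S` of growth layers**; `card_growthLayers_le_of_norm_constantCoeff_charGen`
  (**`‖f_X(0)‖ = p^{−w} ⇒ #S ≤ w`**): the number of layers of the tower in which `rank E(K_n)` grows is at most `ord_p f_X(0)` — by Greenberg's Thm. 4.1 / Perrin-Riou–Schneider,
  in rank `0` this is `ord_p` of the `p`-adic Euler characteristic `#Ш(E/K)[p^∞]·∏ c_v·∏_{v∣p} #Ẽ(k_v)² / #E(K)_{tors}²` (not used here).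
* ★ `mordellWeilRank_layer_eq_of_norm_constantCoeff_charGen_eq_one` — **`f_X(0) ∈ ℤ_pˣ` ⇒ `rank E(K_m) = rank E(K)` at EVERY layer** (the rank never grows in the tower).
* ★★ `exists_mem_factors_charGen_associated_of_mordellWeilRank_lt` — THE ALGEBRAIC MATCHING LAW: growth at layer `n+1` ⇒ the prime factorisation of `f_X` in the UFD `Λ`
  contains `P ~ Ψ_n` (`λ(P) = pⁿ(p−1)`, `μ(P) = 0`, `‖P(0)‖ = p⁻¹`); `mordellWeilRank_layer_succ_eq_of_forall_mem_factors_charGen` (contrapositive).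

References: R. Greenberg, LNM 1716 (1999), Thm. 1.9 (p. 63), Thm. 4.1 (p. 86), §5 p. 132 [GreenbergLNM1716]; L. Washington, GTM 83, §7.1, §13.2 [Washington1997];
B. Perrin-Riou, Invent. Math. 99 (1990) / P. Schneider, Invent. Math. 79 (1985) (Euler characteristic; context only).
-/

set_option linter.dupNamespace false
set_option autoImplicit false

noncomputable section

open scoped Classical Polynomial

namespace Summit.BirchSwinnertonDyer.BirchSwinnertonDyer.Theorems.AlignedTransportAtTwoCyclotomicLayerWeightAlgebraic

open Polynomial WeierstrassCurve Literature.NumberTheory.EllipticCurves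
  Summit.BirchSwinnertonDyer.Rank1Residual.X1.MuLambda
  Summit.BirchSwinnertonDyer.Rank1Residual.X1.ParitySqueeze
  Summit.BirchSwinnertonDyer.Rank1Residual.Iwasawa
  Summit.BirchSwinnertonDyer.BirchSwinnertonDyer.Theorems.AlignedTransportAtTwoCyclotomicLayerPrime
  Summit.BirchSwinnertonDyer.BirchSwinnertonDyer.Theorems.AlignedTransportAtTwoCyclotomicLayerRankDichotomy
  Summit.BirchSwinnertonDyer.BirchSwinnertonDyer.Theorems.AlignedTransportAtTwoCyclotomicLayerRankBudget
  Summit.BirchSwinnertonDyer.BirchSwinnertonDyer.Theorems.AlignedTransportAtTwoCyclotomicLayerWeight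
  Summit.BirchSwinnertonDyer.BirchSwinnertonDyer.Theorems.AlignedTransportAtTwoCyclotomicLayerZero
  Summit.BirchSwinnertonDyer.BirchSwinnertonDyer.Theorems.DefectPrime

universe u

variable {K : Type u} [Field K] [NumberField K] (W : WeierstrassCurve K) [W.IsElliptic] {p : ℕ} [hp : Fact p.Prime]
  {κ : ZpExtension K p} {γ : Field.absoluteGaloisGroup K}

/-- ★★ **THE ALGEBRAIC WEIGHT BUDGET: `‖f_X(0)‖ ≤ p^{−#(growth layers)}`.** `E/K` elliptic over a number field, `K_∞/K` ANY `ℤ_p`-extension with topological generator `γ`, `D` a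
dual datum with `X` finitely generated and torsion, `char_Λ X = (f_X)`, and `S` any finite set of layers `n` with `rank E(K_n) < rank E(K_{n+1})`. Then **`‖f_X(0)‖ ≤ p^{−#S}`**:
each growth layer contributes its prime `Φ_{p^{n+1}}(1+T)` (g36 dichotomy), all simultaneously, each of weight one. [cite: GreenbergLNM1716, Thm. 1.9 (p. 63) and §5 p. 132]
[cite: Washington1997, §13.2] -/
theorem norm_constantCoeff_charGen_le_of_growthLayers (hγ : κ.IsTopGenerator γ) (D : W.SelmerDualData κ γ) [Module.Finite (IwasawaAlgebra p) D.X]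
    (hD : D.IsTorsion) {fX : IwasawaAlgebra p} (hfX : D.charIdeal = Ideal.span {fX}) (S : Finset ℕ)
    (hS : ∀ n ∈ S, (W.baseChange (κ.layer n)).mordellWeilRank < (W.baseChange (κ.layer (n + 1))).mordellWeilRank) :
    ‖PowerSeries.constantCoeff fX‖ ≤ (p : ℝ)⁻¹ ^ S.card := by
  refine norm_constantCoeff_le_of_forall_cyclotomicLayer_dvd S fun n hn ↦ ?_
  rcases mordellWeilRank_layer_succ_eq_or_cyclotomicLayer_dvd_charGen W hγ D hD hfX n with h | h
  · exact absurd h (hS n hn).ne'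
  · exact h

/-- ★★ **`‖f_X(0)‖ = p^{−w}` ⇒ AT MOST `w` LAYERS OF THE TOWER SHOW MORDELL–WEIL GROWTH** (any `ℤ_p`-extension of any number field; `w = ord_p f_X(0)`, the `p`-adic
valuation of the Euler characteristic in rank `0`). [cite: GreenbergLNM1716, Thm. 1.9 (p. 63), Thm. 4.1 (p. 86) and §5 p. 132] -/
theorem card_growthLayers_le_of_norm_constantCoeff_charGen (hγ : κ.IsTopGenerator γ) (D : W.SelmerDualData κ γ) [Module.Finite (IwasawaAlgebra p) D.X]
    (hD : D.IsTorsion) {fX : IwasawaAlgebra p} (hfX : D.charIdeal = Ideal.span {fX}) {w : ℕ} (hw : ‖PowerSeries.constantCoeff fX‖ = (p : ℝ)⁻¹ ^ w)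
    (S : Finset ℕ) (hS : ∀ n ∈ S, (W.baseChange (κ.layer n)).mordellWeilRank < (W.baseChange (κ.layer (n + 1))).mordellWeilRank) :
    S.card ≤ w :=
  card_le_of_forall_cyclotomicLayer_dvd S hw fun n hn ↦ by
    rcases mordellWeilRank_layer_succ_eq_or_cyclotomicLayer_dvd_charGen W hγ D hD hfX n with h | h
    · exact absurd h (hS n hn).ne'
    · exact h

/-- **`f_X(0) ∈ ℤ_pˣ` ⇒ `rank E(K_{n+1}) = rank E(K_n)` at every layer.** [cite: GreenbergLNM1716, Thm. 4.1 (p. 86) and §5 p. 132] -/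
theorem mordellWeilRank_layer_succ_eq_of_norm_constantCoeff_charGen_eq_one (hγ : κ.IsTopGenerator γ) (D : W.SelmerDualData κ γ)
    [Module.Finite (IwasawaAlgebra p) D.X] (hD : D.IsTorsion) {fX : IwasawaAlgebra p} (hfX : D.charIdeal = Ideal.span {fX})
    (hw : ‖PowerSeries.constantCoeff fX‖ = 1) (n : ℕ) :
    (W.baseChange (κ.layer (n + 1))).mordellWeilRank = (W.baseChange (κ.layer n)).mordellWeilRank := by
  rcases mordellWeilRank_layer_succ_eq_or_cyclotomicLayer_dvd_charGen W hγ D hD hfX n with h | h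
  · exact h
  · exact absurd h (not_cyclotomicLayer_dvd_of_norm_constantCoeff_eq_one hw n)

/-- ★ **`f_X(0) ∈ ℤ_pˣ` ⇒ `rank E(K_m) = rank E(K)` AT EVERY LAYER `m`**: the Mordell–Weil rank never grows in a `ℤ_p`-tower whose characteristic power series has unit
constant term (layer `0` is `K` itself by `…CyclotomicLayerZero`). [cite: GreenbergLNM1716, Thm. 1.9 (p. 63) and Thm. 4.1 (p. 86)] [cite: Washington1997, §13.1] -/
theorem mordellWeilRank_layer_eq_of_norm_constantCoeff_charGen_eq_one (hγ : κ.IsTopGenerator γ) (D : W.SelmerDualData κ γ)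
    [Module.Finite (IwasawaAlgebra p) D.X] (hD : D.IsTorsion) {fX : IwasawaAlgebra p} (hfX : D.charIdeal = Ideal.span {fX})
    (hw : ‖PowerSeries.constantCoeff fX‖ = 1) (m : ℕ) : (W.baseChange (κ.layer m)).mordellWeilRank = W.mordellWeilRank := by
  induction m with
  | zero => exact mordellWeilRank_layer_zero W κ
  | succ m ih => rw [mordellWeilRank_layer_succ_eq_of_norm_constantCoeff_charGen_eq_one W hγ D hD hfX hw m, ih]

/-- ★★ **THE ALGEBRAIC MATCHING LAW.** Growth at layer `n+1` ⇒ the prime factorisation of `f_X` in the UFD `Λ` (Mathlib) contains a factor `P ~ Φ_{p^{n+1}}(1+T)`, with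
`λ(P) = pⁿ(p−1)`, `μ(P) = 0` and weight one `‖P(0)‖ = p⁻¹` (`f_X ≠ 0` as `X` is torsion). [cite: GreenbergLNM1716, §5 p. 132] [cite: Washington1997, §7.1 and §13.2] -/
theorem exists_mem_factors_charGen_associated_of_mordellWeilRank_lt (hγ : κ.IsTopGenerator γ) (D : W.SelmerDualData κ γ)
    [Module.Finite (IwasawaAlgebra p) D.X] (hD : D.IsTorsion) {fX : IwasawaAlgebra p} (hfX : D.charIdeal = Ideal.span {fX}) {n : ℕ}
    (hlt : (W.baseChange (κ.layer n)).mordellWeilRank < (W.baseChange (κ.layer (n + 1))).mordellWeilRank) :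
    ∃ P ∈ UniqueFactorizationMonoid.factors (fX : PowerSeries ℤ_[p]),
      Associated ((((cyclotomic (p ^ (n + 1)) ℤ_[p]).comp (X + 1) : ℤ_[p][X]) : PowerSeries ℤ_[p])) P ∧
        lam P = p ^ n * (p - 1) ∧ mu P = 0 ∧ ‖PowerSeries.constantCoeff P‖ = (p : ℝ)⁻¹ := by
  have hfX0 : fX ≠ 0 := by
    intro h0
    refine Module.charIdeal_ne_bot (IwasawaAlgebra p) D.X ?_
    change D.charIdeal = ⊥
    rw [hfX, h0]
    exact Ideal.span_singleton_eq_bot.mpr rfl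
  have h : (((cyclotomic (p ^ (n + 1)) ℤ_[p]).comp (X + 1) : ℤ_[p][X]) : PowerSeries ℤ_[p]) ∣ fX := by
    rcases mordellWeilRank_layer_succ_eq_or_cyclotomicLayer_dvd_charGen W hγ D hD hfX n with h | h
    · exact absurd h hlt.ne'
    · exact h
  obtain ⟨P, hP, hass⟩ := UniqueFactorizationMonoid.exists_mem_factors_of_dvd hfX0 (prime_coe_cyclotomic_comp p n).irreducible h
  exact ⟨P, hP, hass, lam_mu_norm_of_associated_cyclotomicLayer hass⟩

/-- **Stationarity from the factor table of `f_X`**: no prime factor of degree `pⁿ(p−1)` and weight one ⇒ `rank E(K_{n+1}) = rank E(K_n)`.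
[cite: GreenbergLNM1716, §5 p. 132] [cite: Washington1997, §13.2] -/
theorem mordellWeilRank_layer_succ_eq_of_forall_mem_factors_charGen (hγ : κ.IsTopGenerator γ) (D : W.SelmerDualData κ γ)
    [Module.Finite (IwasawaAlgebra p) D.X] (hD : D.IsTorsion) {fX : IwasawaAlgebra p} (hfX : D.charIdeal = Ideal.span {fX}) {n : ℕ}
    (hno : ∀ P ∈ UniqueFactorizationMonoid.factors (fX : PowerSeries ℤ_[p]),
      lam P ≠ p ^ n * (p - 1) ∨ ‖PowerSeries.constantCoeff P‖ ≠ (p : ℝ)⁻¹) :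
    (W.baseChange (κ.layer (n + 1))).mordellWeilRank = (W.baseChange (κ.layer n)).mordellWeilRank := by
  by_contra hne
  have hlt : (W.baseChange (κ.layer n)).mordellWeilRank < (W.baseChange (κ.layer (n + 1))).mordellWeilRank :=
    lt_of_le_of_ne (mordellWeilRank_layer_le_succ W κ n) (Ne.symm hne)
  obtain ⟨P, hP, -, hl, -, hw⟩ := exists_mem_factors_charGen_associated_of_mordellWeilRank_lt W hγ D hD hfX hlt
  rcases hno P hP with h | h
  · exact h hl
  · exact h hw

/-- **Cyclotomic tower over a number field, no finiteness hypothesis** (`X` is finitely generated automatically): `‖f_X(0)‖ ≤ p^{−#S}`.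
[cite: GreenbergLNM1716, Thm. 1.9 (p. 63) and §1 p. 60] -/
theorem norm_constantCoeff_charGen_le_of_growthLayers_of_isCyclotomic (hκ : κ.IsCyclotomic) (hγ : κ.IsTopGenerator γ) (D : W.SelmerDualData κ γ)
    (hD : D.IsTorsion) {fX : IwasawaAlgebra p} (hfX : D.charIdeal = Ideal.span {fX}) (S : Finset ℕ)
    (hS : ∀ n ∈ S, (W.baseChange (κ.layer n)).mordellWeilRank < (W.baseChange (κ.layer (n + 1))).mordellWeilRank) :
    ‖PowerSeries.constantCoeff fX‖ ≤ (p : ℝ)⁻¹ ^ S.card := by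
  haveI : Module.Finite (IwasawaAlgebra p) D.X := D.module_finite_of_isCyclotomic W κ hκ hγ
  exact norm_constantCoeff_charGen_le_of_growthLayers W hγ D hD hfX S hS

end Summit.BirchSwinnertonDyer.BirchSwinnertonDyer.Theorems.AlignedTransportAtTwoCyclotomicLayerWeightAlgebraic
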